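import Summits.Ventures.PercRepro.C041TriDomPendantSibling
import Summits.Ventures.PercRepro.C041TriDomSimpleCore

/-!
# ROW C-041 — THEOREM (REDUCTION TO SIMPLE CORES, SIBLING-FREE): CONJECTURE (STOCHASTIC DOMINATION) ON THE SIMPLE
CORES ALONE GIVES IT EVERYWHERE (p6, gen 50; P6-TWOEXIT-LEAN.md §53 ADDENDUM 24)

THEOREM (REDUCTION TO SIMPLE CORES) (`cyc_and_sib_of_noDoubleCore`, `C041TriDomSimpleCore`) carried the conjecture
AND the sibling domination through the reductions, because the gluing at a cut vertex needs the sibling of the near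
side.  THEOREM (THE SIBLING DOMINATION) (`sibDominationS_all`, `C041TriDomPendantSibling`) holds on every status of every
host, so the second hypothesis is void: CONJECTURE (STOCHASTIC DOMINATION) on every host-stocked status WITHOUT a
double edge, a cut, a two-exit piece, a redundant edge, a parallel pair or a markless 2-cut far side, of every host on
the given types, gives the conjecture on every host-stocked status of every host (`cycDominationS_of_noDoubleCore'`)
and, for a plain finite host, the conjecture from the cores of its stocked host (`cycDomination_of_noDoubleCore_host'`).
-/

namespace PercRepro

namespace ZoneZ

namespace MultiExit

open ZoneData Finset

variable {V₁ E₁ U₁ U₂ : Type} (Z₁ : ZoneData V₁ E₁ U₁ U₂)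

section Induction

variable [Fintype E₁] [DecidableEq E₁]

/-- **THEOREM (REDUCTION TO SIMPLE CORES, SIBLING-FREE)**: CONJECTURE (STOCHASTIC DOMINATION) on the host-stocked
statuses without a double edge, a cut, a two-exit piece, a redundant edge, a parallel pair or a markless 2-cut far
side, for all marks, of every host on the given types, gives it on every host-stocked status of every host. -/
theorem cycDominationS_of_noDoubleCore'
    (hbase : ∀ (Z : ZoneData V₁ E₁ U₁ U₂) (st : E₁ → EStat), StockedH Z st → NoDouble st → ∀ a b c : V₁,
      ¬ HasCut Z st a b c → ¬ HasTwoExit Z st a b c → ¬ HasRedundant Z st → ¬ HasParallel Z st →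
      ¬ HasTwoCut Z st a b c → CycDominationS Z a b c st)
    (Z : ZoneData V₁ E₁ U₁ U₂) {st : E₁ → EStat} (hs : StockedH Z st) (x y z : V₁) : CycDominationS Z x y z st :=
  cycDominationS_of_noDoubleCore
    (fun Z st hs hnd a b c h1 h2 h3 h4 h5 => ⟨hbase Z st hs hnd a b c h1 h2 h3 h4 h5, sibDominationS_all Z c st a b⟩)
    Z hs x y z


/-! ## Leaf marks are not cores either -/

/-- A mark of the status with at least two present edges: no single edge `f` makes it a `LeafS`. -/
def NoLeaf (Z : ZoneData V₁ E₁ U₁ U₂) (st : E₁ → EStat) (m : V₁) : Prop := ∀ f, ¬ LeafS Z st m f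

/-- **THEOREM (REDUCTION TO SIMPLE CORES WITH NO LEAF MARK)**: the cores may be assumed to have every mark of degree
at least two — a core with a leaf mark satisfies the conjecture by THEOREM (LEAF MARK). -/
theorem cycDominationS_of_noDoubleCore''
    (hbase : ∀ (Z : ZoneData V₁ E₁ U₁ U₂) (st : E₁ → EStat), StockedH Z st → NoDouble st → ∀ a b c : V₁,
      ¬ HasCut Z st a b c → ¬ HasTwoExit Z st a b c → ¬ HasRedundant Z st → ¬ HasParallel Z st →
      ¬ HasTwoCut Z st a b c → NoLeaf Z st a → NoLeaf Z st b → NoLeaf Z st c → CycDominationS Z a b c st)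
    (Z : ZoneData V₁ E₁ U₁ U₂) {st : E₁ → EStat} (hs : StockedH Z st) (x y z : V₁) : CycDominationS Z x y z st := by
  refine cycDominationS_of_noDoubleCore' (fun Z st hs hnd a b c h1 h2 h3 h4 h5 => ?_) Z hs x y z
  by_cases ha : NoLeaf Z st a
  · by_cases hb : NoLeaf Z st b
    · by_cases hc : NoLeaf Z st c
      · exact hbase Z st hs hnd a b c h1 h2 h3 h4 h5 ha hb hc
      · obtain ⟨f, hf⟩ := not_forall.mp hc
        exact cycDominationS_of_leafS_exit' Z st a b c (not_not.mp hf)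
    · obtain ⟨f, hf⟩ := not_forall.mp hb
      exact cycDominationS_of_leafS_exit Z st a b c (not_not.mp hf)
  · obtain ⟨f, hf⟩ := not_forall.mp ha
    exact cycDominationS_of_leafS Z st a b c (not_not.mp hf)

/-! ## The cut-vertex gluing without the sibling -/

/-- **THEOREM (CUT-VERTEX GLUING, SIBLING-FREE)**: if `v` separates `z` from the marks `x, y`, CONJECTURE
(STOCHASTIC DOMINATION) for `(x, y, z)` follows from the conjecture for `(x, y, v)` on the near side alone — the
sibling domination of the near side is THEOREM (THE SIBLING DOMINATION). -/
theorem cycDominationS_of_cutVertex' (st : E₁ → EStat) (x y z v : V₁) (hz : z ≠ v) (hx : x ∉ side Z₁ st v z)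
    (hy : y ∉ side Z₁ st v z) (h1 : CycDominationS Z₁ x y v (stOutS Z₁ st v z)) : CycDominationS Z₁ x y z st :=
  cycDominationS_of_cutVertex Z₁ st x y z v hz hx hy h1 (sibDominationS_all Z₁ v (stOutS Z₁ st v z) x y)

end Induction

section Host

variable [Fintype E₁] [DecidableEq E₁] [Fintype V₁] [DecidableEq V₁]

/-- **THEOREM (REDUCTION TO SIMPLE CORES, PLAIN HOSTS, SIBLING-FREE)**: CONJECTURE (STOCHASTIC DOMINATION) on a finite
host follows from the conjecture alone on the host-stocked statuses without double edges of the hosts on the types of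
its stocked host that have no cut, no two-exit piece, no redundant edge, no parallel pair and no markless 2-cut far
side. -/
theorem cycDomination_of_noDoubleCore_host'
    (hbase : ∀ (Z : ZoneData V₁ (E₁ ⊕ Chords (V₁ := V₁) (E₁ := E₁)) U₁ U₂)
      (st : E₁ ⊕ Chords (V₁ := V₁) (E₁ := E₁) → EStat), StockedH Z st → NoDouble st → ∀ a b c : V₁,
      ¬ HasCut Z st a b c → ¬ HasTwoExit Z st a b c → ¬ HasRedundant Z st → ¬ HasParallel Z st →
      ¬ HasTwoCut Z st a b c → CycDominationS Z a b c st)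
    (x y z : V₁) : CycDomination Z₁ x y z :=
  cycDomination_of_noDoubleCore_host Z₁
    (fun Z st hs hnd a b c h1 h2 h3 h4 h5 => ⟨hbase Z st hs hnd a b c h1 h2 h3 h4 h5, sibDominationS_all Z c st a b⟩)
    x y z

end Host

end MultiExit

end ZoneZ

end PercRepro
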